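import Mathlib.Analysis.SpecialFunctions.Pow.Real
import Summits.MatrixMultiplication.MatrixMultiplication.Statement
import Literature.Computability.AlgebraicComplexity.CohnUmansOmegaTwoCriterion
import Literature.Computability.AlgebraicComplexity.WreathCharDegreePowSum
import Literature.Barriers.MatrixMultiplication.PackingBoundSequences
import Literature.Barriers.MatrixMultiplication.QuasirandomBarrierPowersAlternating
import HarnessLib

/-!
# The group-theoretic door (Cohn–Umans 2003, Cor. 4.3) and the portrait of the missing family

The one route to `ω = 2` through finite groups is Cohn–Umans' criterion (FOCS 2003, Cor. 4.3;
the tree's `CohnUmans2003_cor43`): a sequence of finite groups `Gᵢ` realizing `⟨nᵢ, mᵢ, pᵢ⟩`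
through subsets with the triple product property, with character degrees `≤ dᵢ`, `dᵢ³ < nᵢmᵢpᵢ`,
pseudo-exponents `αᵢ = 3 log|Gᵢ| / log(nᵢmᵢpᵢ) → 2` and `(αᵢ − 2)/(γᵢ − 2) → 0`
(`γᵢ = log|Gᵢ| / log dᵢ`), forces `ω(ℂ) = 2`.  No such family is known (Cohn–Umans 2003 §7;
Blasiak–Cohn–Grochow–Pratt–Umans 2023, §1).  This file states the door over the summit constant and
proves, from the tree's barrier library, what any family entering it must look like:

* `matrixMultiplication_of_tppFamily` — **the door**: the Cor. 4.3 hypotheses imply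
  `MatrixMultiplication`.
* `charDegreePowSum_lt_rpow_of_bound_lt` — the engine, for one group: if
  `3(log|G| − 2 log d)/(log N − 3 log d) < w` (`N = nmp`, `2 ≤ w`) then `Σ_χ χ(1)^w < N^{w/3}`,
  i.e. the group **beats the `w`-certificate bound** of BCGPU 2023, Thm. 3.2 / (2.2).
* `tppFamily_eventually_beats_certificate` — along a door family, for every `w > 2`, eventually
  `Σ_χ χ(1)^w < Nᵢ^{w/3}`; `meetsPackingBound_of_tppFamily` — the family **meets the packing bound**
  (`MeetsPackingBound`, BCGPU 2023 Def. 2.3: TPP triples of size `|Gᵢ|^{3/2 − o(1)}`).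
* The portrait (`tppFamily_…`): `|Gᵢ| → ∞`; eventually non-abelian; the second-smallest character
  degree is sub-polynomial, `n(Gᵢ) < c|Gᵢ|^δ` eventually for every `c, δ > 0` (so the family is
  outside BCGPU Cor. 3.3, in particular outside every family of simple groups of Lie type of bounded
  rank); and `n(Gᵢ) < 4` or `(n(Gᵢ)/4)^{2/3} < k(Gᵢ)^ε` eventually, for every `ε > 0`
  (`k` = class number; BCGPU Thm. 3.2 in the "few classes" form).
* The catalogued classes it cannot be drawn from are derived in the companion file
  `SoloInformedGroupDoorExclusions.lean` (`GL_n`, `SL_n`, `PSL_n` over all finite fields and ranks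
  `≥ 2`; `SL_n(𝔽_q)^k` with one parameter fixed; powers of one fixed group).

What is NOT excluded by anything in the tree (the open residual of the door, recorded in print):
the alternating groups (`alternatingGroup_not_cor33_hypothesis`: they escape Cor. 3.3), powers
`SL_n(𝔽_q)^m` with `q` and `m` both unbounded, subsets of products `∏ GL_{nᵢ}(𝔽_{qᵢ})` that are not
subgroups, and — through the separate abelian two-families door `matrixMultiplication_of_twoFamilies`
(CKSU 2005, Thm. 4.4 / Conj. 4.7) — simultaneous double product families in abelian groups of
unbounded exponent.

[cite: CohnUmans2003, Cor. 4.3, Lemma 3.1, Cor. 4.2]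
[cite: BlasiakCohnGrochowPrattUmans2023, Def. 2.3, Thm. 3.2, Cor. 3.3, Cor. 3.4, Cor. 3.5, §5]
[cite: Sawin2018, Thm. 1.5]
[cite: CohnKleinbergSzegedyUmans2005, Thm. 4.4, Conj. 4.7]
-/

noncomputable section

namespace Summit.MatrixMultiplication.MatrixMultiplication.Theorems

open Filter Topology
open scoped MatrixGroups
open Literature.Computability.AlgebraicComplexity
open Literature.RepresentationTheory.FiniteGroups Literature.Combinatorics.Additive
open Literature.Barriers.MatrixMultiplication

/-! ## §1 The door -/

/-- **Door D2 (Cohn–Umans 2003, Cor. 4.3)** over the summit constant: a sequence of finite groups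
`Gᵢ` realizing `⟨nᵢ, mᵢ, pᵢ⟩` with character degrees `≤ dᵢ`, `2 ≤ dᵢ`, `dᵢ³ < nᵢmᵢpᵢ`,
`αᵢ → 2` and `(αᵢ − 2)/(γᵢ − 2) → 0` gives `ω = 2`.  The tree's `CohnUmans2003_cor43`, restated
with conclusion `MatrixMultiplication`. [cite: CohnUmans2003, Cor. 4.3] -/
theorem matrixMultiplication_of_tppFamily (G : ℕ → Type) [∀ i, Group (G i)] [∀ i, Finite (G i)]
    (n m p d : ℕ → ℕ)
    (h : ∀ i, RealizesTPP (G i) (n i) (m i) (p i)) (hd : ∀ i, maxCharDegree (G i) ≤ d i)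
    (hd2 : ∀ i, 2 ≤ d i) (hlt : ∀ i, d i ^ 3 < n i * m i * p i)
    (hα : Tendsto (fun i => 3 * Real.log (Nat.card (G i)) / Real.log ((n i * m i * p i : ℕ) : ℝ))
      atTop (𝓝 2))
    (ho : Tendsto (fun i => (3 * Real.log (Nat.card (G i)) / Real.log ((n i * m i * p i : ℕ) : ℝ) - 2) /
        (Real.log (Nat.card (G i)) / Real.log (d i) - 2)) atTop (𝓝 0)) :
    _root_.MatrixMultiplication :=
  _root_.MatrixMultiplication_iff.2 (CohnUmans2003_cor43 G n m p d h hd hd2 hlt hα ho)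

/-! ## §2 The engine for one group: beating the `w`-certificate bound -/

/-- Numerical facts attached to the Cor. 4.2 data of one group: `1 < nmp`, `0 < log(nmp)`,
`3 log d < log(nmp)`, `0 < log d`, and (Lemma 3.1) `2 log(nmp) < 3 log|G|`, `2 log d < log|G|`.
[cite: CohnUmans2003, Lemma 3.1, Cor. 4.2] -/
theorem tppData_log_facts {G : Type} [Group G] [Finite G] {n m p d : ℕ}
    (h : RealizesTPP G n m p) (hd2 : 2 ≤ d) (hlt : d ^ 3 < n * m * p) :
    1 < n * m * p ∧ 0 < Real.log ((n * m * p : ℕ) : ℝ) ∧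
      3 * Real.log d < Real.log ((n * m * p : ℕ) : ℝ) ∧ 0 < Real.log d ∧
      2 * Real.log ((n * m * p : ℕ) : ℝ) < 3 * Real.log (Nat.card G) ∧
      2 * Real.log d < Real.log (Nat.card G) := by
  haveI := Fintype.ofFinite G
  have hN1 : 1 < n * m * p :=
    lt_of_lt_of_le (by nlinarith [hd2, Nat.le_self_pow three_ne_zero d]) hlt.le
  have hNpos : 0 < Real.log ((n * m * p : ℕ) : ℝ) := Real.log_pos (by exact_mod_cast hN1)
  have hℓd : 0 < Real.log d := Real.log_pos (by exact_mod_cast hd2)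
  have hℓN : 3 * Real.log d < Real.log ((n * m * p : ℕ) : ℝ) := by
    have h3 : ((d : ℝ)) ^ 3 < ((n * m * p : ℕ) : ℝ) := by exact_mod_cast hlt
    have := Real.log_lt_log (by positivity) h3
    rwa [Real.log_pow] at this
  have h31 := CohnUmans2003_lemma31_log h hN1
  rw [← Nat.card_eq_fintype_card] at h31
  exact ⟨hN1, hNpos, hℓN, hℓd, h31, by linarith⟩

/-- **The engine (Cohn–Umans 2003, proof of Cor. 4.2, read contrapositively).**  If the character
degrees of `G` are `≤ d`, `2 ≤ d`, `d³ < N := nmp`, and the Cor. 4.2 bound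
`B = 3(log|G| − 2 log d)/(log N − 3 log d)` is `< w` for some `w ≥ 2`, then
`Σ_χ χ(1)^w ≤ d^{w−2}|G| < N^{w/3}`: the group beats the `w`-certificate bound (BCGPU 2023, (2.2)).
[cite: CohnUmans2003, Cor. 4.2 (proof)] [cite: BlasiakCohnGrochowPrattUmans2023, Thm. 2.2] -/
theorem charDegreePowSum_lt_rpow_of_bound_lt {G : Type} [Group G] [Finite G] {n m p d : ℕ}
    (h : RealizesTPP G n m p) (hd : maxCharDegree G ≤ d) (hd2 : 2 ≤ d) (hlt : d ^ 3 < n * m * p)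
    {w : ℝ} (hw2 : 2 ≤ w)
    (hw : 3 * (Real.log (Nat.card G) - 2 * Real.log d) /
      (Real.log ((n * m * p : ℕ) : ℝ) - 3 * Real.log d) < w) :
    charDegreePowSum G w < ((n * m * p : ℕ) : ℝ) ^ (w / 3) := by
  obtain ⟨hN1, hNpos, hℓN, hℓd, -, -⟩ := tppData_log_facts h hd2 hlt
  have hG0 : (0 : ℝ) < Nat.card G := by exact_mod_cast Nat.card_pos
  have hd0 : (0 : ℝ) < d := by exact_mod_cast (lt_of_lt_of_le zero_lt_two hd2)
  have hN0 : (0 : ℝ) < ((n * m * p : ℕ) : ℝ) := by exact_mod_cast (lt_trans zero_lt_one hN1)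
  have hden : 0 < Real.log ((n * m * p : ℕ) : ℝ) - 3 * Real.log d := by linarith
  rw [div_lt_iff₀ hden] at hw
  have key : Real.log d * (w - 2) + Real.log (Nat.card G) <
      Real.log ((n * m * p : ℕ) : ℝ) * (w / 3) := by
    linarith
  calc charDegreePowSum G w ≤ (maxCharDegree G : ℝ) ^ (w - 2) * Nat.card G :=
        charDegreePowSum_le_maxCharDegree_rpow_mul_card G hw2
    _ ≤ (d : ℝ) ^ (w - 2) * Nat.card G :=
        mul_le_mul_of_nonneg_right
          (Real.rpow_le_rpow (by positivity) (by exact_mod_cast hd) (by linarith)) hG0.le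
    _ = Real.exp (Real.log d * (w - 2) + Real.log (Nat.card G)) := by
        rw [Real.exp_add, Real.rpow_def_of_pos hd0, Real.exp_log hG0]
    _ < Real.exp (Real.log ((n * m * p : ℕ) : ℝ) * (w / 3)) := Real.exp_lt_exp.2 key
    _ = ((n * m * p : ℕ) : ℝ) ^ (w / 3) := (Real.rpow_def_of_pos hN0 _).symm

/-- The Cor. 4.2 bound in the `α, γ` coordinates of Cor. 4.3: with `α = 3 log|G|/log N`,
`γ = log|G|/log d`, one has `α / (1 − (α − 2)/(γ − 2)) = 3(log|G| − 2 log d)/(log N − 3 log d)`.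
[cite: CohnUmans2003, Cor. 4.2, Cor. 4.3 (proof)] -/
theorem cuBound_alphaGamma_eq_log {G : Type} [Group G] [Finite G] {n m p d : ℕ}
    (h : RealizesTPP G n m p) (hd2 : 2 ≤ d) (hlt : d ^ 3 < n * m * p) :
    (3 * Real.log (Nat.card G) / Real.log ((n * m * p : ℕ) : ℝ)) /
        (1 - (3 * Real.log (Nat.card G) / Real.log ((n * m * p : ℕ) : ℝ) - 2) /
          (Real.log (Nat.card G) / Real.log d - 2)) =
      3 * (Real.log (Nat.card G) - 2 * Real.log d) /
        (Real.log ((n * m * p : ℕ) : ℝ) - 3 * Real.log d) := by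
  obtain ⟨-, hNpos, hℓN, hℓd, h31, hL2⟩ := tppData_log_facts h hd2 hlt
  set L := Real.log (Nat.card G) with hLdef
  set ℓN := Real.log ((n * m * p : ℕ) : ℝ) with hℓNdef
  set ℓd := Real.log (d : ℝ) with hℓddef
  have hL : 0 < L := by linarith
  have hL0 : L ≠ 0 := hL.ne'
  have hℓd0 : ℓd ≠ 0 := hℓd.ne'
  have hℓN0 : ℓN ≠ 0 := hNpos.ne'
  have hden0 : ℓN - 3 * ℓd ≠ 0 := (sub_pos.2 hℓN).ne'
  have hL20 : L - 2 * ℓd ≠ 0 := (sub_pos.2 hL2).ne'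
  have e1 : 1 - (3 * L / ℓN - 2) / (L / ℓd - 2) = L * (ℓN - 3 * ℓd) / (ℓN * (L - 2 * ℓd)) := by
    have hγ2 : L / ℓd - 2 = (L - 2 * ℓd) / ℓd := by field_simp
    have hα2 : 3 * L / ℓN - 2 = (3 * L - 2 * ℓN) / ℓN := by field_simp
    rw [hγ2, hα2]
    field_simp
    ring
  rw [e1]
  field_simp

/-! ## §3 What a door family must do -/

section Family

variable (G : ℕ → Type) [∀ i, Group (G i)] (n m p d : ℕ → ℕ)

/-- **A door family beats every certificate bound.**  Under the Cor. 4.3 hypotheses, for every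
`w > 2`, eventually `Σ_χ χ(1)^w (Gᵢ) < (nᵢmᵢpᵢ)^{w/3}` — the negation of the `w`-certificate
inequality (2.2) of BCGPU 2023 for the realizing TPP triple.
[cite: CohnUmans2003, Cor. 4.3 (proof)] [cite: BlasiakCohnGrochowPrattUmans2023, Thm. 2.2] -/
theorem tppFamily_eventually_beats_certificate [∀ i, Finite (G i)]
    (h : ∀ i, RealizesTPP (G i) (n i) (m i) (p i)) (hd : ∀ i, maxCharDegree (G i) ≤ d i)
    (hd2 : ∀ i, 2 ≤ d i) (hlt : ∀ i, d i ^ 3 < n i * m i * p i)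
    (hα : Tendsto (fun i => 3 * Real.log (Nat.card (G i)) / Real.log ((n i * m i * p i : ℕ) : ℝ))
      atTop (𝓝 2))
    (ho : Tendsto (fun i => (3 * Real.log (Nat.card (G i)) / Real.log ((n i * m i * p i : ℕ) : ℝ) - 2) /
        (Real.log (Nat.card (G i)) / Real.log (d i) - 2)) atTop (𝓝 0))
    {w : ℝ} (hw : 2 < w) :
    ∀ᶠ i in atTop, charDegreePowSum (G i) w < ((n i * m i * p i : ℕ) : ℝ) ^ (w / 3) := by
  set α : ℕ → ℝ := fun i => 3 * Real.log (Nat.card (G i)) / Real.log ((n i * m i * p i : ℕ) : ℝ)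
    with hαdef
  set γ : ℕ → ℝ := fun i => Real.log (Nat.card (G i)) / Real.log (d i) with hγdef
  have hlim : Tendsto (fun i => α i / (1 - (α i - 2) / (γ i - 2))) atTop (𝓝 2) := by
    have h1 : Tendsto (fun i => 1 - (α i - 2) / (γ i - 2)) atTop (𝓝 (1 - 0)) :=
      tendsto_const_nhds.sub ho
    have := hα.div h1 (by norm_num)
    rw [sub_zero, div_one] at this
    exact this
  filter_upwards [hlim.eventually_lt_const hw] with i hi
  refine charDegreePowSum_lt_rpow_of_bound_lt (h i) (hd i) (hd2 i) (hlt i) hw.le ?_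
  rw [← cuBound_alphaGamma_eq_log (h i) (hd2 i) (hlt i)]
  exact hi

/-- The same, packaged with the realizing triple: for every `ε > 0`, eventually some TPP triple
`(S, T, U)` of `Gᵢ` has `Σ_χ χ(1)^{2+ε} < (|S||T||U|)^{(2+ε)/3}`.
[cite: CohnUmans2003, Cor. 4.3 (proof)] [cite: BlasiakCohnGrochowPrattUmans2023, Thm. 2.2] -/
theorem tppFamily_eventually_exists_tpp_beating [∀ i, Finite (G i)]
    (h : ∀ i, RealizesTPP (G i) (n i) (m i) (p i)) (hd : ∀ i, maxCharDegree (G i) ≤ d i)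
    (hd2 : ∀ i, 2 ≤ d i) (hlt : ∀ i, d i ^ 3 < n i * m i * p i)
    (hα : Tendsto (fun i => 3 * Real.log (Nat.card (G i)) / Real.log ((n i * m i * p i : ℕ) : ℝ))
      atTop (𝓝 2))
    (ho : Tendsto (fun i => (3 * Real.log (Nat.card (G i)) / Real.log ((n i * m i * p i : ℕ) : ℝ) - 2) /
        (Real.log (Nat.card (G i)) / Real.log (d i) - 2)) atTop (𝓝 0))
    {ε : ℝ} (hε : 0 < ε) :
    ∀ᶠ i in atTop, ∃ S T U : Finset (G i), TripleProductProperty S T U ∧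
      charDegreePowSum (G i) (2 + ε) < ((S.card * T.card * U.card : ℕ) : ℝ) ^ ((2 + ε) / 3) := by
  filter_upwards [tppFamily_eventually_beats_certificate G n m p d h hd hd2 hlt hα ho
    (by linarith : (2 : ℝ) < 2 + ε)] with i hi
  obtain ⟨S, T, U, hS, hT, hU, hTPP⟩ := h i
  refine ⟨S, T, U, hTPP, ?_⟩
  rw [hS, hT, hU]
  exact hi

/-- **A door family meets the packing bound** (BCGPU 2023, Def. 2.3): `αᵢ → 2` alone gives TPP
triples of size `|Gᵢ|^{3/2 − ε}` eventually, for every `ε > 0`.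
[cite: BlasiakCohnGrochowPrattUmans2023, Def. 2.3] [cite: CohnUmans2003, Cor. 4.3] -/
theorem meetsPackingBound_of_tppFamily [∀ i, Fintype (G i)]
    (h : ∀ i, RealizesTPP (G i) (n i) (m i) (p i))
    (hd2 : ∀ i, 2 ≤ d i) (hlt : ∀ i, d i ^ 3 < n i * m i * p i)
    (hα : Tendsto (fun i => 3 * Real.log (Nat.card (G i)) / Real.log ((n i * m i * p i : ℕ) : ℝ))
      atTop (𝓝 2)) :
    MeetsPackingBound G := by
  classical
  have h' : ∀ i, ∃ S T U : Finset (G i), S.card = n i ∧ T.card = m i ∧ U.card = p i ∧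
      TripleProductProperty S T U := h
  choose S T U hS hT hU hTPP using h'
  refine ⟨S, T, U, hTPP, fun ε hε => ?_⟩
  have hN : ∀ i, (S i).card * (T i).card * (U i).card = n i * m i * p i := fun i => by
    rw [hS, hT, hU]
  have hN1 : ∀ i, 1 < n i * m i * p i := fun i => (tppData_log_facts (h i) (hd2 i) (hlt i)).1
  by_cases hε' : 3 / 2 ≤ ε
  · refine Filter.Eventually.of_forall fun i => ?_
    have hG1 : (1 : ℝ) ≤ Fintype.card (G i) := by exact_mod_cast Fintype.card_pos
    have hN1' : (1 : ℝ) ≤ (((S i).card * (T i).card * (U i).card : ℕ) : ℝ) := by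
      rw [hN]; exact_mod_cast (hN1 i).le
    exact (Real.rpow_le_one_of_one_le_of_nonpos hG1 (by linarith)).trans hN1'
  · push Not at hε'
    have hc : (2 : ℝ) < 3 / (3 / 2 - ε) := by
      rw [lt_div_iff₀ (by linarith)]; linarith
    filter_upwards [hα.eventually_lt_const hc] with i hi
    have hℓN : 0 < Real.log ((n i * m i * p i : ℕ) : ℝ) := Real.log_pos (by exact_mod_cast hN1 i)
    have hG0 : (0 : ℝ) < Fintype.card (G i) := by exact_mod_cast Fintype.card_pos
    have hN0 : (0 : ℝ) < ((n i * m i * p i : ℕ) : ℝ) := by exact_mod_cast (zero_lt_one.trans (hN1 i))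
    rw [Nat.card_eq_fintype_card, div_lt_div_iff₀ hℓN (by linarith)] at hi
    have key : Real.log (Fintype.card (G i)) * (3 / 2 - ε) ≤
        Real.log ((n i * m i * p i : ℕ) : ℝ) := by nlinarith
    calc (Fintype.card (G i) : ℝ) ^ (3 / 2 - ε : ℝ)
        = Real.exp (Real.log (Fintype.card (G i)) * (3 / 2 - ε)) := Real.rpow_def_of_pos hG0 _
      _ ≤ Real.exp (Real.log ((n i * m i * p i : ℕ) : ℝ)) := Real.exp_le_exp.2 key
      _ = ((n i * m i * p i : ℕ) : ℝ) := Real.exp_log hN0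
      _ = (((S i).card * (T i).card * (U i).card : ℕ) : ℝ) := by rw [hN]

/-- **Portrait, 1: the orders tend to infinity.** [cite: BlasiakCohnGrochowPrattUmans2023, Def. 2.3]
[cite: CohnUmans2003, Lemma 3.1] -/
theorem tppFamily_tendsto_card [∀ i, Fintype (G i)]
    (h : ∀ i, RealizesTPP (G i) (n i) (m i) (p i))
    (hd2 : ∀ i, 2 ≤ d i) (hlt : ∀ i, d i ^ 3 < n i * m i * p i)
    (hα : Tendsto (fun i => 3 * Real.log (Nat.card (G i)) / Real.log ((n i * m i * p i : ℕ) : ℝ))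
      atTop (𝓝 2)) :
    Tendsto (fun i => Fintype.card (G i)) atTop atTop :=
  (meetsPackingBound_of_tppFamily G n m p d h hd2 hlt hα).tendsto_card_atTop
    (Filter.Eventually.of_forall fun i => by
      have h1 := (h i).one_lt_card
        (((hd2 i).trans (Nat.le_self_pow three_ne_zero (d i))).trans (hlt i).le)
      rw [Nat.card_eq_fintype_card] at h1
      exact Fintype.one_lt_card_iff_nontrivial.1 h1)

/-- **Portrait, 2: eventually non-abelian** (an abelian group realizing `⟨n,m,p⟩` has `nmp ≤ |G|`,
i.e. pseudo-exponent `3`; Cohn–Umans 2003, Lemma 3.1). [cite: CohnUmans2003, Lemma 3.1]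
[cite: BlasiakCohnGrochowPrattUmans2023, Cor. 3.5] -/
theorem tppFamily_eventually_nonabelian [∀ i, Fintype (G i)]
    (h : ∀ i, RealizesTPP (G i) (n i) (m i) (p i))
    (hd2 : ∀ i, 2 ≤ d i) (hlt : ∀ i, d i ^ 3 < n i * m i * p i)
    (hα : Tendsto (fun i => 3 * Real.log (Nat.card (G i)) / Real.log ((n i * m i * p i : ℕ) : ℝ))
      atTop (𝓝 2)) :
    ∀ᶠ i in atTop, ∃ a b : G i, a * b ≠ b * a := by
  filter_upwards [hα.eventually_lt_const (by norm_num : (2 : ℝ) < 3)] with i hi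
  by_contra hc
  push Not at hc
  obtain ⟨S, T, U, hS, hT, hU, hTPP⟩ := h i
  have hle := tripleProductProperty_card_le_of_comm hc hTPP
  rw [hS, hT, hU] at hle
  have hN1 : 1 < n i * m i * p i := (tppData_log_facts (h i) (hd2 i) (hlt i)).1
  have hℓN : 0 < Real.log ((n i * m i * p i : ℕ) : ℝ) := Real.log_pos (by exact_mod_cast hN1)
  have hlog : Real.log ((n i * m i * p i : ℕ) : ℝ) ≤ Real.log (Nat.card (G i)) := by
    rw [Nat.card_eq_fintype_card]
    exact Real.log_le_log (by exact_mod_cast (zero_lt_one.trans hN1)) (by exact_mod_cast hle)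
  rw [div_lt_iff₀ hℓN] at hi
  linarith

/-- **Portrait, 3: outside BCGPU Cor. 3.3** — the second-smallest character degree cannot stay
polynomially large: for all `c, δ > 0` it is false that `c|Gᵢ|^δ ≤ n(Gᵢ)` eventually (in
particular the family is not one of simple groups of Lie type of bounded rank).
[cite: BlasiakCohnGrochowPrattUmans2023, Cor. 3.3, Cor. 3.4] -/
theorem tppFamily_not_cor33_hypothesis [∀ i, Fintype (G i)]
    (h : ∀ i, RealizesTPP (G i) (n i) (m i) (p i))
    (hd2 : ∀ i, 2 ≤ d i) (hlt : ∀ i, d i ^ 3 < n i * m i * p i)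
    (hα : Tendsto (fun i => 3 * Real.log (Nat.card (G i)) / Real.log ((n i * m i * p i : ℕ) : ℝ))
      atTop (𝓝 2)) {c δ : ℝ} (hc : 0 < c) (hδ : 0 < δ) :
    ¬ ∀ᶠ i in atTop, c * (Fintype.card (G i) : ℝ) ^ δ ≤ secondCharDegree (G i) :=
  fun hn => BCGPU2023_cor33_seq G hc hδ hn (meetsPackingBound_of_tppFamily G n m p d h hd2 hlt hα)

/-- **Portrait, 3′: `n(Gᵢ) = |Gᵢ|^{o(1)}`** — the eventual form: for all `c, δ > 0`, eventually
`n(Gᵢ) < c|Gᵢ|^δ` (from the full Cor. 4.3 hypotheses, via the tree's uniform form of BCGPU Thm. 3.2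
for `n(G) ≥ c|G|^δ`, `exists_eps_noCertificate_of_secondCharDegree_ge`).
[cite: BlasiakCohnGrochowPrattUmans2023, Thm. 3.2, Cor. 3.3] -/
theorem tppFamily_eventually_secondCharDegree_lt [∀ i, Fintype (G i)]
    (h : ∀ i, RealizesTPP (G i) (n i) (m i) (p i)) (hd : ∀ i, maxCharDegree (G i) ≤ d i)
    (hd2 : ∀ i, 2 ≤ d i) (hlt : ∀ i, d i ^ 3 < n i * m i * p i)
    (hα : Tendsto (fun i => 3 * Real.log (Nat.card (G i)) / Real.log ((n i * m i * p i : ℕ) : ℝ))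
      atTop (𝓝 2))
    (ho : Tendsto (fun i => (3 * Real.log (Nat.card (G i)) / Real.log ((n i * m i * p i : ℕ) : ℝ) - 2) /
        (Real.log (Nat.card (G i)) / Real.log (d i) - 2)) atTop (𝓝 0))
    {c δ : ℝ} (hc : 0 < c) (hδ : 0 < δ) :
    ∀ᶠ i in atTop, (secondCharDegree (G i) : ℝ) < c * (Fintype.card (G i) : ℝ) ^ δ := by
  obtain ⟨ε, hε, N₀, hN₀⟩ := exists_eps_noCertificate_of_secondCharDegree_ge hc hδ
  have hcard := tppFamily_tendsto_card G n m p d h hd2 hlt hα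
  have hbig : ∀ᶠ i in atTop, N₀ ≤ (Fintype.card (G i) : ℝ) := by
    obtain ⟨M, hM⟩ := exists_nat_ge N₀
    filter_upwards [hcard.eventually_ge_atTop M] with i hi
    exact hM.trans (by exact_mod_cast hi)
  filter_upwards [hbig, tppFamily_eventually_nonabelian G n m p d h hd2 hlt hα,
    tppFamily_eventually_exists_tpp_beating G n m p d h hd hd2 hlt hα ho hε] with i hiN hiab hib
  obtain ⟨S, T, U, hTPP, hlt'⟩ := hib
  by_contra hge
  push Not at hge
  have := hN₀ (G i) hiab hiN hge S T U hTPP (2 + ε) (by linarith) le_rfl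
  linarith

/-- **Portrait, 4: BCGPU Thm. 3.2 in the "few classes" form.**  For every `ε > 0`, eventually
`n(Gᵢ) < 4` or `(n(Gᵢ)/4)^{2/3} < k(Gᵢ)^ε` (`k` = number of conjugacy classes): the minimal
non-linear degree is sub-polynomial in the class number.
[cite: BlasiakCohnGrochowPrattUmans2023, Thm. 3.2 (proof)] -/
theorem tppFamily_eventually_few_classes_fails [∀ i, Fintype (G i)]
    (h : ∀ i, RealizesTPP (G i) (n i) (m i) (p i)) (hd : ∀ i, maxCharDegree (G i) ≤ d i)
    (hd2 : ∀ i, 2 ≤ d i) (hlt : ∀ i, d i ^ 3 < n i * m i * p i)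
    (hα : Tendsto (fun i => 3 * Real.log (Nat.card (G i)) / Real.log ((n i * m i * p i : ℕ) : ℝ))
      atTop (𝓝 2))
    (ho : Tendsto (fun i => (3 * Real.log (Nat.card (G i)) / Real.log ((n i * m i * p i : ℕ) : ℝ) - 2) /
        (Real.log (Nat.card (G i)) / Real.log (d i) - 2)) atTop (𝓝 0))
    {ε : ℝ} (hε : 0 < ε) :
    ∀ᶠ i in atTop, secondCharDegree (G i) < 4 ∨
      ((secondCharDegree (G i) : ℝ) / 4) ^ (2 / 3 : ℝ) < (Nat.card (ConjClasses (G i)) : ℝ) ^ ε := by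
  filter_upwards [tppFamily_eventually_nonabelian G n m p d h hd2 hlt hα,
    tppFamily_eventually_exists_tpp_beating G n m p d h hd hd2 hlt hα ho hε] with i hiab hib
  obtain ⟨S, T, U, hTPP, hlt'⟩ := hib
  by_contra hc
  push Not at hc
  obtain ⟨h4, hk⟩ := hc
  have := noCertificate_of_few_classes (G i) hiab h4 hk S T U hTPP (w := 2 + ε) (by linarith) le_rfl
  linarith

end Family

end Summit.MatrixMultiplication.MatrixMultiplication.Theorems

end
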